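import Summits.MatrixMultiplication.MatrixMultiplication.Theses.CondensationDistance
import Literature.Computability.AlgebraicComplexity.NonscalarBilinearRank
import Literature.Computability.AlgebraicComplexity.MatrixMultiplicationConjectureForms

/-!
# Sketch — crux-ideate round 1 (ideator 2) for `DerivationsBoundOmega` (stmt-MatrixMultiplication-15940)

Part A (PROVED, sorry-free, axioms `propext, Classical.choice, Quot.sound`): the two new generic lemmas of
card `cubic-truncation` —
* `cubicTruncation` : degree-3 truncation of a nonscalar computation (cubic parts are `∑_k U_k V_k W_k`,
  `W_k` linear), the degree-3 analogue of `IsNonscalarSeq.exists_quadratic_forms`;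
* `exists_triads_trilinear_of_isNonscalarSeq` : `R ≤ 6 · L^{ns}` for the trilinear coefficient tensor of ONE
  cost-free cubic (degree-3 analogue of `exists_triads_of_isNonscalarSeq`).

Part B (STATEMENTS only, elaborated): the remaining first lemmas / transfer targets of the two cards —
* card `cubic-truncation` — `CubicTruncation` (= Part A, `cubicTruncation_holds`), `TrilinearExtraction`
  (= Part A, `trilinearExtraction_holds`), `BlockCubicComponent`, transfer target `UniformRankBound`;
* card `adjugate-jet` — `TruncatedDivision`, `UnipotentAdjugate`, transfer target `UniformRankBound'`.
-/

set_option linter.dupNamespace false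

noncomputable section

namespace Summit.MatrixMultiplication.MatrixMultiplication.Cruxes.DerivationsBoundOmega.Ideas

open Literature.Computability.AlgebraicComplexity MvPolynomial
open scoped BigOperators

/-! ## Part A — proofs -/

universe u v

variable {R : Type u} [CommSemiring R] {σ : Type v}

/-- The span of the "cubic slices" `U_k V_k w`, `w` a linear form, of a list of pairs `(U_k, V_k)`. -/
def cubicSlices (l : List (MvPolynomial σ R × MvPolynomial σ R)) : Submodule R (MvPolynomial σ R) :=
  Submodule.span R {q | ∃ uv ∈ l, ∃ w : MvPolynomial σ R, w.IsHomogeneous 1 ∧ q = uv.1 * uv.2 * w}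

theorem cubicSlices_mono_cons (a : MvPolynomial σ R × MvPolynomial σ R)
    (l : List (MvPolynomial σ R × MvPolynomial σ R)) : cubicSlices l ≤ cubicSlices (a :: l) :=
  Submodule.span_mono fun _ ⟨uv, huv, w, hw, hq⟩ => ⟨uv, List.mem_cons_of_mem _ huv, w, hw, hq⟩

/-- A linear form times an element of `span (pairProducts l)` is a cubic slice combination. -/
theorem mul_mem_cubicSlices {l : List (MvPolynomial σ R × MvPolynomial σ R)} {w q : MvPolynomial σ R}
    (hw : w.IsHomogeneous 1) (hq : q ∈ Submodule.span R (pairProducts l)) :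
    w * q ∈ cubicSlices l := by
  induction hq using Submodule.span_induction with
  | mem x hx =>
    obtain ⟨uv, huv, rfl⟩ := hx
    refine Submodule.subset_span ⟨uv, huv, w, hw, ?_⟩
    ring
  | zero => simp
  | add x y _ _ hx hy =>
    rw [mul_add]
    exact add_mem hx hy
  | smul a x _ hx =>
    rw [mul_smul_comm]
    exact Submodule.smul_mem _ _ hx

/-- `(u v)₃ = u₀ v₃ + u₁ v₂ + u₂ v₁ + u₃ v₀`: the cubic part of a product lies in every submodule
containing the cubic parts of the factors and the two mixed products. -/
theorem homogeneousComponent_three_mul_mem {M : Submodule R (MvPolynomial σ R)}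
    {u v : MvPolynomial σ R} (hu : homogeneousComponent 3 u ∈ M)
    (hv : homogeneousComponent 3 v ∈ M)
    (h12 : homogeneousComponent 1 u * homogeneousComponent 2 v ∈ M)
    (h21 : homogeneousComponent 2 u * homogeneousComponent 1 v ∈ M) :
    homogeneousComponent 3 (u * v) ∈ M := by
  classical
  have hprod : u * v = ∑ i ∈ Finset.range (u.totalDegree + 1),
      ∑ j ∈ Finset.range (v.totalDegree + 1),
        homogeneousComponent i u * homogeneousComponent j v := by
    conv_lhs => rw [← sum_homogeneousComponent u, ← sum_homogeneousComponent v]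
    rw [Finset.sum_mul_sum]
  rw [hprod, map_sum]
  refine Submodule.sum_mem _ fun i _ => ?_
  rw [map_sum]
  refine Submodule.sum_mem _ fun j _ => ?_
  have hmem : homogeneousComponent i u * homogeneousComponent j v ∈
      homogeneousSubmodule σ R (i + j) :=
    (mem_homogeneousSubmodule _ _).2
      ((homogeneousComponent_isHomogeneous i u).mul (homogeneousComponent_isHomogeneous j v))
  rw [homogeneousComponent_of_mem hmem]
  split_ifs with hij
  · have hi : i ≤ 3 := by omega
    interval_cases i
    · obtain rfl : j = 3 := by omega
      rw [homogeneousComponent_zero, ← smul_eq_C_mul]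
      exact M.smul_mem _ hv
    · obtain rfl : j = 2 := by omega
      exact h12
    · obtain rfl : j = 1 := by omega
      exact h21
    · obtain rfl : j = 0 := by omega
      rw [homogeneousComponent_zero, mul_comm, ← smul_eq_C_mul]
      exact M.smul_mem _ hu
  · exact zero_mem _

/-- `1` has no cubic part. -/
theorem homogeneousComponent_three_one : homogeneousComponent 3 (1 : MvPolynomial σ R) = 0 :=
  homogeneousComponent_eq_zero _ _ (by simp)

/-- Variables have no cubic part. -/
theorem homogeneousComponent_three_X (i : σ) :
    homogeneousComponent 3 (X i : MvPolynomial σ R) = 0 := by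
  rw [homogeneousComponent_of_mem ((mem_homogeneousSubmodule _ _).2 (isHomogeneous_X R i))]
  simp

/-- **Joint degree-2 / degree-3 truncation of a nonscalar computation.** For a nonscalar computation
sequence of length `n` there are `n` pairs of linear forms `(U_k, V_k)` such that, for every cost-free
polynomial `p`, the quadratic part `p₂` is an `R`-combination of the `U_k V_k` AND the cubic part
`p₃` is a combination of cubic slices `U_k V_k w` (`w` linear). -/
theorem exists_quadratic_cubic_forms {gs : List (MvPolynomial σ R)} (h : IsNonscalarSeq gs) :
    ∃ l : List (MvPolynomial σ R × MvPolynomial σ R), l.length = gs.length ∧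
      (∀ uv ∈ l, uv.1.IsHomogeneous 1 ∧ uv.2.IsHomogeneous 1) ∧
      ∀ p ∈ freeSpan {x | x ∈ gs},
        homogeneousComponent 2 p ∈ Submodule.span R (pairProducts l) ∧
        homogeneousComponent 3 p ∈ cubicSlices l := by
  induction gs with
  | nil =>
    refine ⟨[], rfl, by simp, fun p hp => ⟨?_, ?_⟩⟩
    · refine apply_mem_of_mem_freeSpan (homogeneousComponent 2) ?_ ?_ ?_ hp
      · rw [homogeneousComponent_two_one]
        exact zero_mem _
      · intro i
        rw [homogeneousComponent_two_X]
        exact zero_mem _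
      · intro s hs
        simp at hs
    · refine apply_mem_of_mem_freeSpan (homogeneousComponent 3) ?_ ?_ ?_ hp
      · rw [homogeneousComponent_three_one]
        exact zero_mem _
      · intro i
        rw [homogeneousComponent_three_X]
        exact zero_mem _
      · intro s hs
        simp at hs
  | cons g gs ih =>
    obtain ⟨hgs, u, hu, v, hv, rfl⟩ := h
    obtain ⟨l, hlen, hhom, hspan⟩ := ih hgs
    have hmono2 : Submodule.span R (pairProducts l) ≤
        Submodule.span R (pairProducts ((homogeneousComponent 1 u, homogeneousComponent 1 v) :: l)) :=
      Submodule.span_mono (pairProducts_mono_cons _ _)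
    have hmono3 : cubicSlices l ≤
        cubicSlices ((homogeneousComponent 1 u, homogeneousComponent 1 v) :: l) :=
      cubicSlices_mono_cons _ _
    refine ⟨(homogeneousComponent 1 u, homogeneousComponent 1 v) :: l, by simp [hlen], ?_,
      fun p hp => ⟨?_, ?_⟩⟩
    · intro uv huv
      rw [List.mem_cons] at huv
      rcases huv with rfl | huv
      · exact ⟨homogeneousComponent_isHomogeneous 1 u, homogeneousComponent_isHomogeneous 1 v⟩
      · exact hhom uv huv
    · refine apply_mem_of_mem_freeSpan (homogeneousComponent 2) ?_ ?_ ?_ hp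
      · rw [homogeneousComponent_two_one]
        exact zero_mem _
      · intro i
        rw [homogeneousComponent_two_X]
        exact zero_mem _
      · intro s hs
        simp only [Set.mem_setOf_eq, List.mem_cons] at hs
        rcases hs with rfl | hs
        · refine homogeneousComponent_two_mul_mem (hmono2 (hspan u hu).1) (hmono2 (hspan v hv).1) ?_
          exact Submodule.subset_span ⟨_, List.mem_cons_self, rfl⟩
        · exact hmono2 (hspan s (mem_freeSpan_of_mem hs)).1
    · refine apply_mem_of_mem_freeSpan (homogeneousComponent 3) ?_ ?_ ?_ hp
      · rw [homogeneousComponent_three_one]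
        exact zero_mem _
      · intro i
        rw [homogeneousComponent_three_X]
        exact zero_mem _
      · intro s hs
        simp only [Set.mem_setOf_eq, List.mem_cons] at hs
        rcases hs with rfl | hs
        · refine homogeneousComponent_three_mul_mem (hmono3 (hspan u hu).2) (hmono3 (hspan v hv).2)
            ?_ ?_
          · exact hmono3 (mul_mem_cubicSlices (homogeneousComponent_isHomogeneous 1 u) (hspan v hv).1)
          · rw [mul_comm]
            exact hmono3 (mul_mem_cubicSlices (homogeneousComponent_isHomogeneous 1 v) (hspan u hu).1)
        · exact hmono3 (hspan s (mem_freeSpan_of_mem hs)).2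

/-- From membership in `cubicSlices l` to ONE linear form per pair: `q = ∑_k U_k V_k W_k`. -/
theorem exists_linear_forms_of_mem_cubicSlices {l : List (MvPolynomial σ R × MvPolynomial σ R)}
    {q : MvPolynomial σ R} (hq : q ∈ cubicSlices l) :
    ∃ W : Fin l.length → MvPolynomial σ R, (∀ k, (W k).IsHomogeneous 1) ∧
      q = ∑ k, (l.get k).1 * (l.get k).2 * W k := by
  classical
  induction hq using Submodule.span_induction with
  | mem x hx =>
    obtain ⟨uv, huv, w, hw, rfl⟩ := hx
    obtain ⟨k, rfl⟩ := List.mem_iff_get.1 huv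
    refine ⟨Pi.single k w, fun j => ?_, ?_⟩
    · by_cases hj : j = k
      · subst hj
        simpa using hw
      · rw [Pi.single_eq_of_ne hj]
        exact isHomogeneous_zero σ R 1
    · rw [Finset.sum_eq_single k]
      · simp
      · intro j _ hj
        rw [Pi.single_eq_of_ne hj, mul_zero]
      · intro hk
        exact absurd (Finset.mem_univ k) hk
  | zero =>
    exact ⟨0, fun _ => isHomogeneous_zero σ R 1, by simp⟩
  | add x y _ _ hx hy =>
    obtain ⟨W₁, hW₁, rfl⟩ := hx
    obtain ⟨W₂, hW₂, rfl⟩ := hy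
    refine ⟨W₁ + W₂, fun k => (hW₁ k).add (hW₂ k), ?_⟩
    rw [← Finset.sum_add_distrib]
    refine Finset.sum_congr rfl fun k _ => ?_
    simp only [Pi.add_apply]
    ring
  | smul a x _ hx =>
    obtain ⟨W, hW, rfl⟩ := hx
    refine ⟨fun k => a • W k, fun k => ?_, ?_⟩
    · show (a • W k).IsHomogeneous 1
      rw [smul_eq_C_mul]
      simpa using (isHomogeneous_C σ a).mul (hW k)
    · rw [Finset.smul_sum]
      refine Finset.sum_congr rfl fun k _ => ?_
      rw [mul_smul_comm]

/-- **Cubic truncation (first lemma of the card, explicit form).** -/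
theorem cubicTruncation {gs : List (MvPolynomial σ R)} (h : IsNonscalarSeq gs) :
    ∃ l : List (MvPolynomial σ R × MvPolynomial σ R), l.length = gs.length ∧
      (∀ uv ∈ l, uv.1.IsHomogeneous 1 ∧ uv.2.IsHomogeneous 1) ∧
      ∀ p ∈ freeSpan {x | x ∈ gs},
        homogeneousComponent 2 p ∈ Submodule.span R (pairProducts l) ∧
        ∃ W : Fin l.length → MvPolynomial σ R, (∀ k, (W k).IsHomogeneous 1) ∧
          homogeneousComponent 3 p = ∑ k, (l.get k).1 * (l.get k).2 * W k := by
  obtain ⟨l, hlen, hhom, hspan⟩ := exists_quadratic_cubic_forms h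
  exact ⟨l, hlen, hhom, fun p hp => ⟨(hspan p hp).1,
    exists_linear_forms_of_mem_cubicSlices (hspan p hp).2⟩⟩

/-! ### Trilinear coefficients of products of three linear forms -/

section Trilinear

variable [DecidableEq σ]

/-- A degree-one exponent `e` with `d + e = single x 1 + single y 1 + single z 1` is one of
`single x 1`, `single y 1`, `single z 1`. -/
theorem single_of_degree_one_of_add_eq {d e : σ →₀ ℕ} {x y z : σ}
    (he : Finsupp.degree e = 1)
    (hde : d + e = Finsupp.single x 1 + Finsupp.single y 1 + Finsupp.single z 1) :
    e = Finsupp.single x 1 ∨ e = Finsupp.single y 1 ∨ e = Finsupp.single z 1 := by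
  obtain ⟨w, rfl⟩ := Finsupp.exists_eq_single_of_degree_eq_one he
  have hw := DFunLike.congr_fun hde w
  simp only [Finsupp.coe_add, Pi.add_apply, Finsupp.single_eq_same, Finsupp.single_apply] at hw
  by_cases hx : x = w
  · exact Or.inl (by rw [hx])
  · by_cases hy : y = w
    · exact Or.inr (Or.inl (by rw [hy]))
    · by_cases hz : z = w
      · exact Or.inr (Or.inr (by rw [hz]))
      · rw [if_neg hx, if_neg hy, if_neg hz] at hw
        omega

/-- **Trilinear coefficient of `(U V) · W`** for `W` linear and pairwise distinct variables:
`coeff_{xyz}((UV) W) = coeff_{xy}(UV) W_z + coeff_{xz}(UV) W_y + coeff_{yz}(UV) W_x`. -/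
theorem coeff_mul_of_isHomogeneous_one_right {Q W : MvPolynomial σ R} (hW : W.IsHomogeneous 1)
    {x y z : σ} (hxy : x ≠ y) (hyz : y ≠ z) (hxz : x ≠ z) :
    coeff (Finsupp.single x 1 + Finsupp.single y 1 + Finsupp.single z 1) (Q * W) =
      coeff (Finsupp.single x 1 + Finsupp.single y 1) Q * coeff (Finsupp.single z 1) W +
        coeff (Finsupp.single x 1 + Finsupp.single z 1) Q * coeff (Finsupp.single y 1) W +
          coeff (Finsupp.single y 1 + Finsupp.single z 1) Q * coeff (Finsupp.single x 1) W := by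
  set sx : σ →₀ ℕ := Finsupp.single x 1 with hsx
  set sy : σ →₀ ℕ := Finsupp.single y 1 with hsy
  set sz : σ →₀ ℕ := Finsupp.single z 1 with hsz
  have hinj : ∀ {a b : σ}, (Finsupp.single a 1 : σ →₀ ℕ) = Finsupp.single b 1 → a = b :=
    fun h => Finsupp.single_left_injective (by norm_num) h
  -- the three contributing pairs
  have h12 : ((sx + sy, sz) : (σ →₀ ℕ) × (σ →₀ ℕ)) ≠ (sx + sz, sy) := by
    intro h
    exact hyz (hinj (Prod.mk.inj h).2.symm)
  have h13 : ((sx + sy, sz) : (σ →₀ ℕ) × (σ →₀ ℕ)) ≠ (sy + sz, sx) := by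
    intro h
    exact hxz (hinj (Prod.mk.inj h).2).symm
  have h23 : ((sx + sz, sy) : (σ →₀ ℕ) × (σ →₀ ℕ)) ≠ (sy + sz, sx) := by
    intro h
    exact hxy (hinj (Prod.mk.inj h).2).symm
  rw [coeff_mul]
  have hsub : ({(sx + sy, sz), (sx + sz, sy), (sy + sz, sx)} : Finset ((σ →₀ ℕ) × (σ →₀ ℕ))) ⊆
      Finset.HasAntidiagonal.antidiagonal (sx + sy + sz) := by
    intro p hp
    simp only [Finset.mem_insert, Finset.mem_singleton] at hp
    rw [Finset.HasAntidiagonal.mem_antidiagonal]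
    rcases hp with rfl | rfl | rfl
    · rfl
    · show sx + sz + sy = sx + sy + sz
      abel
    · show sy + sz + sx = sx + sy + sz
      abel
  rw [← Finset.sum_subset hsub]
  · rw [Finset.sum_insert (by simp [h12, h13]), Finset.sum_insert (by simp [h23]),
      Finset.sum_singleton]
    ring
  · intro p hp hpn
    rw [Finset.HasAntidiagonal.mem_antidiagonal] at hp
    by_contra hprod
    have hW0 : coeff p.2 W ≠ 0 := fun h0 => hprod (by rw [h0, mul_zero])
    have hd2 : Finsupp.degree p.2 = 1 := by
      by_contra h
      exact hW0 (hW.coeff_eq_zero h)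
    have hp' : p.1 + p.2 = sx + sy + sz := hp
    rcases single_of_degree_one_of_add_eq hd2 hp' with h2 | h2 | h2
    · have h2' : p.2 = sx := h2.trans hsx.symm
      have h1 : p.1 = sy + sz := by
        have h0 := hp'
        rw [h2'] at h0
        have h' : p.1 + sx = (sy + sz) + sx := by rw [h0]; abel
        exact add_right_cancel h'
      refine hpn ?_
      rw [Finset.mem_insert, Finset.mem_insert, Finset.mem_singleton]
      exact Or.inr (Or.inr (Prod.ext h1 h2'))
    · have h2' : p.2 = sy := h2.trans hsy.symm
      have h1 : p.1 = sx + sz := by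
        have h0 := hp'
        rw [h2'] at h0
        have h' : p.1 + sy = (sx + sz) + sy := by rw [h0]; abel
        exact add_right_cancel h'
      refine hpn ?_
      rw [Finset.mem_insert, Finset.mem_insert, Finset.mem_singleton]
      exact Or.inr (Or.inl (Prod.ext h1 h2'))
    · have h2' : p.2 = sz := h2.trans hsz.symm
      have h1 : p.1 = sx + sy := by
        have h0 := hp'
        rw [h2'] at h0
        exact add_right_cancel h0
      refine hpn ?_
      rw [Finset.mem_insert, Finset.mem_insert, Finset.mem_singleton]
      exact Or.inl (Prod.ext h1 h2')

/-- **The six-term formula**: for linear forms `U, V, W` and pairwise distinct variables,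
`coeff_{xyz}(U V W) = Σ_{π ∈ S₃} U_{π x} V_{π y} W_{π z}`. -/
theorem coeff_mul_mul_of_isHomogeneous_one {U V W : MvPolynomial σ R} (hU : U.IsHomogeneous 1)
    (hV : V.IsHomogeneous 1) (hW : W.IsHomogeneous 1) {x y z : σ} (hxy : x ≠ y) (hyz : y ≠ z)
    (hxz : x ≠ z) :
    coeff (Finsupp.single x 1 + Finsupp.single y 1 + Finsupp.single z 1) (U * V * W) =
      (coeff (Finsupp.single x 1) U * coeff (Finsupp.single y 1) V +
          coeff (Finsupp.single y 1) U * coeff (Finsupp.single x 1) V) *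
        coeff (Finsupp.single z 1) W +
      (coeff (Finsupp.single x 1) U * coeff (Finsupp.single z 1) V +
          coeff (Finsupp.single z 1) U * coeff (Finsupp.single x 1) V) *
        coeff (Finsupp.single y 1) W +
      (coeff (Finsupp.single y 1) U * coeff (Finsupp.single z 1) V +
          coeff (Finsupp.single z 1) U * coeff (Finsupp.single y 1) V) *
        coeff (Finsupp.single x 1) W := by
  rw [coeff_mul_of_isHomogeneous_one_right hW hxy hyz hxz,
    coeff_mul_of_isHomogeneous_one hU hV hxy, coeff_mul_of_isHomogeneous_one hU hV hxz,
    coeff_mul_of_isHomogeneous_one hU hV hyz]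

end Trilinear

/-! ### From one computation sequence to a triad decomposition of the trilinear coefficients -/

/-- **`R ≤ 6 · L^{ns}` for the trilinear coefficient tensor of ONE cost-free cubic** (second lemma of
the card): for three pairwise distinct variable families `x, y, z` and a polynomial `p` in the
cost-free span of a nonscalar computation sequence of length `≤ N`, the 3-tensor
`t(c, a, b) = coeff_{x_a y_b z_c}(p)` is a sum of at most `6N` triads. -/
theorem exists_triads_trilinear_of_isNonscalarSeq [DecidableEq σ] {α : Type*} {β : Type*}
    {γ : Type*} (x : α → σ) (y : β → σ) (z : γ → σ) (hxy : ∀ a b, x a ≠ y b)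
    (hyz : ∀ b c, y b ≠ z c) (hxz : ∀ a c, x a ≠ z c) {N : ℕ} (p : MvPolynomial σ R)
    (h : ∃ gs : List (MvPolynomial σ R), IsNonscalarSeq gs ∧ gs.length ≤ N ∧
      p ∈ freeSpan {q | q ∈ gs}) :
    ∃ r : ℕ, r ≤ 6 * N ∧ ∃ (w : Fin r → γ → R) (u : Fin r → α → R) (v : Fin r → β → R),
      ∀ c a b, ∑ ρ, w ρ c * u ρ a * v ρ b =
        coeff (Finsupp.single (x a) 1 + Finsupp.single (y b) 1 + Finsupp.single (z c) 1) p := by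
  classical
  obtain ⟨gs, hgs, hlen, hp⟩ := h
  obtain ⟨l, hl, hhom, hspan⟩ := cubicTruncation hgs
  obtain ⟨W, hW, hW3⟩ := (hspan p hp).2
  have hU : ∀ k : Fin l.length, (l.get k).1.IsHomogeneous 1 := fun k => (hhom _ (List.get_mem l k)).1
  have hV : ∀ k : Fin l.length, (l.get k).2.IsHomogeneous 1 := fun k => (hhom _ (List.get_mem l k)).2
  -- coefficients of the variable `s` in the linear forms `U_k`, `V_k`, `W_k`
  let cU : σ → Fin l.length → R := fun s k => coeff (Finsupp.single s 1) (l.get k).1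
  let cV : σ → Fin l.length → R := fun s k => coeff (Finsupp.single s 1) (l.get k).2
  let cW : σ → Fin l.length → R := fun s k => coeff (Finsupp.single s 1) (W k)
  -- the six families of triads (one per bijection {x,y,z} → {U,V,W}), indexed by `Fin 6 × Fin n`:
  -- U_x V_y W_z, U_y V_x W_z, U_x V_z W_y, U_z V_x W_y, U_y V_z W_x, U_z V_y W_x
  let u' : Fin 6 × Fin l.length → α → R := fun ρ a =>
    ![cU (x a) ρ.2, cV (x a) ρ.2, cU (x a) ρ.2, cV (x a) ρ.2, cW (x a) ρ.2, cW (x a) ρ.2] ρ.1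
  let v' : Fin 6 × Fin l.length → β → R := fun ρ b =>
    ![cV (y b) ρ.2, cU (y b) ρ.2, cW (y b) ρ.2, cW (y b) ρ.2, cU (y b) ρ.2, cV (y b) ρ.2] ρ.1
  let w' : Fin 6 × Fin l.length → γ → R := fun ρ c =>
    ![cW (z c) ρ.2, cW (z c) ρ.2, cV (z c) ρ.2, cU (z c) ρ.2, cV (z c) ρ.2, cU (z c) ρ.2] ρ.1
  let e := (finProdFinEquiv (m := 6) (n := l.length))
  refine ⟨6 * l.length, by omega, fun ρ => w' (e.symm ρ), fun ρ => u' (e.symm ρ),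
    fun ρ => v' (e.symm ρ), fun c a b => ?_⟩
  have hdeg : Finsupp.degree
      (Finsupp.single (x a) 1 + Finsupp.single (y b) 1 + Finsupp.single (z c) 1) = 3 := by
    rw [map_add, map_add, Finsupp.degree_single, Finsupp.degree_single, Finsupp.degree_single]
  have hsix : ∀ k : Fin l.length, ∑ i : Fin 6, w' (i, k) c * u' (i, k) a * v' (i, k) b =
      coeff (Finsupp.single (x a) 1 + Finsupp.single (y b) 1 + Finsupp.single (z c) 1)
        ((l.get k).1 * (l.get k).2 * W k) := by
    intro k
    rw [coeff_mul_mul_of_isHomogeneous_one (hU k) (hV k) (hW k) (hxy a b) (hyz b c) (hxz a c)]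
    simp only [Fin.sum_univ_succ, Fin.sum_univ_zero, w', u', v', cU, cV, cW, Matrix.cons_val_zero,
      Matrix.cons_val_succ]
    simp
    ring
  calc ∑ ρ : Fin (6 * l.length), w' (e.symm ρ) c * u' (e.symm ρ) a * v' (e.symm ρ) b
      = ∑ ρ : Fin 6 × Fin l.length, w' ρ c * u' ρ a * v' ρ b :=
        Fintype.sum_equiv e.symm _ _ fun _ => rfl
    _ = ∑ k : Fin l.length, ∑ i : Fin 6, w' (i, k) c * u' (i, k) a * v' (i, k) b := by
        rw [Fintype.sum_prod_type, Finset.sum_comm]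
    _ = ∑ k : Fin l.length, coeff (Finsupp.single (x a) 1 + Finsupp.single (y b) 1 +
          Finsupp.single (z c) 1) ((l.get k).1 * (l.get k).2 * W k) :=
        Finset.sum_congr rfl fun k _ => hsix k
    _ = coeff (Finsupp.single (x a) 1 + Finsupp.single (y b) 1 + Finsupp.single (z c) 1)
          (∑ k : Fin l.length, (l.get k).1 * (l.get k).2 * W k) := by
        rw [coeff_sum]
    _ = coeff (Finsupp.single (x a) 1 + Finsupp.single (y b) 1 + Finsupp.single (z c) 1)
          (homogeneousComponent 3 p) := by
        rw [hW3]
    _ = coeff (Finsupp.single (x a) 1 + Finsupp.single (y b) 1 + Finsupp.single (z c) 1) p := by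
        rw [coeff_homogeneousComponent, if_pos hdeg]


/-! ## Part B — statements -/

/-! ## Card `cubic-truncation` -/

/-- FIRST LEMMA (cubic truncation of a nonscalar computation; degree-3 analogue of
`IsNonscalarSeq.exists_quadratic_forms`, BCS Thm. (4.11)/Prop. (14.1) one degree up): with the SAME
list of linear-part pairs `(U_k, V_k)`, the cubic part of every cost-free polynomial is
`∑_k U_k V_k W_k` for LINEAR forms `W_k` (depending on the polynomial). -/
def CubicTruncation : Prop :=
  ∀ (R : Type) [CommSemiring R] (σ : Type) (gs : List (MvPolynomial σ R)), IsNonscalarSeq gs →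
    ∃ l : List (MvPolynomial σ R × MvPolynomial σ R), l.length = gs.length ∧
      (∀ uv ∈ l, uv.1.IsHomogeneous 1 ∧ uv.2.IsHomogeneous 1) ∧
      ∀ p ∈ freeSpan {x | x ∈ gs},
        homogeneousComponent 2 p ∈ Submodule.span R (pairProducts l) ∧
        ∃ W : Fin l.length → MvPolynomial σ R, (∀ k, (W k).IsHomogeneous 1) ∧
          homogeneousComponent 3 p = ∑ k, (l.get k).1 * (l.get k).2 * W k

/-- Second lemma (trilinear coefficient extraction, degree-3 analogue of
`exists_triads_of_isNonscalarSeq`): for three pairwise distinct variable families the 3-tensor of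
coefficients of the squarefree monomials `x_a y_b z_c` of ONE cost-free polynomial is a sum of `≤ 6N`
triads (`6` = the number of ways to distribute `x, y, z` over the three linear factors `U_k, V_k, W_k`). -/
def TrilinearExtraction : Prop :=
  ∀ (R : Type) [CommSemiring R] (σ : Type) [DecidableEq σ] (α β γ : Type)
    (x : α → σ) (y : β → σ) (z : γ → σ),
    (∀ a b, x a ≠ y b) → (∀ b c, y b ≠ z c) → (∀ a c, x a ≠ z c) →
    ∀ (N : ℕ) (p : MvPolynomial σ R),
      (∃ gs : List (MvPolynomial σ R), IsNonscalarSeq gs ∧ gs.length ≤ N ∧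
        p ∈ freeSpan {q | q ∈ gs}) →
      ∃ r : ℕ, r ≤ 6 * N ∧ ∃ (w : Fin r → γ → R) (u : Fin r → α → R) (v : Fin r → β → R),
        ∀ c a b, ∑ ρ, w ρ c * u ρ a * v ρ b =
          coeff (Finsupp.single (x a) 1 + Finsupp.single (y b) 1 + Finsupp.single (z c) 1) p

/-- The block matrix `M(A,B,C) = [[I, A, 0], [0, I, B], [C, 0, I]]` over the polynomial ring in the
`3 t²` variables `(g, i, j)`, `g = 0, 1, 2` naming the group `A, B, C`: entry `((bi, i), (bj, j))` is
`δ_{ij}` on the diagonal blocks, the variable `X (bi, i, j)` on the block `(bi, bi + 1)` (indices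
mod 3), and `0` elsewhere. -/
def blockM (t : ℕ) :
    Matrix (Fin 3 × Fin t) (Fin 3 × Fin t) (MvPolynomial (Fin 3 × Fin t × Fin t) ℂ) :=
  Matrix.of fun p q =>
    if p.1 = q.1 then (if p.2 = q.2 then 1 else 0)
    else if q.1 = p.1 + 1 then X (p.1, p.2, q.2) else 0

/-- Third lemma (the embedding): `det M(A,B,C) = det (I_t + C A B)`, so its homogeneous components
of degree `1, 2` vanish, degree `0` is `1`, and degree `3` is the matrix multiplication trilinear
form `tr (C A B) = ∑ c_{ki} a_{ij} b_{jk}`. -/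
def BlockCubicComponent : Prop :=
  ∀ t : ℕ,
    homogeneousComponent 3 (blockM t).det =
        ∑ i : Fin t, ∑ j : Fin t, ∑ k : Fin t,
          X ((2 : Fin 3), k, i) * X ((0 : Fin 3), i, j) * X ((1 : Fin 3), j, k) ∧
      homogeneousComponent 0 (blockM t).det = 1 ∧
      homogeneousComponent 1 (blockM t).det = 0 ∧ homogeneousComponent 2 (blockM t).det = 0

/-- TRANSFER TARGET `C⁺` (uniform, non-asymptotic rank inequality; `C⁺ → DerivationsBoundOmega` is
exponent bookkeeping with `n := 3t`): a derivation of `det X` (X the leading `3t × 3t` block of the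
generic `3t × m'` matrix) of length `s` over `ℂ(Z)` gives `R(⟨t,t,t⟩) ≤ 24 s`. -/
def UniformRankBound : Prop :=
  ∀ (t m' : ℕ) (h : 3 * t ≤ m') (s : ℕ),
    Derivable ℂ s
      (Set.range fun p : Fin (3 * t) × Fin m' =>
        algebraMap (MvPolynomial (Fin (3 * t) × Fin m') ℂ)
          (FractionRing (MvPolynomial (Fin (3 * t) × Fin m') ℂ)) (MvPolynomial.X p))
      {algebraMap (MvPolynomial (Fin (3 * t) × Fin m') ℂ)
        (FractionRing (MvPolynomial (Fin (3 * t) × Fin m') ℂ))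
        (Matrix.det (Matrix.of fun i j : Fin (3 * t) => MvPolynomial.X (i, Fin.castLE h j)))} →
    tensorRank (matMulTensor ℂ t t t) ≤ 24 * s

/-! ## Card `adjugate-jet` -/

/-- FIRST LEMMA (exact division removal to degree 3 by a truncated unit inverse, 3 extra
multiplications): if `D · f` and `D` are cost-free for one nonscalar sequence and `D(0) ≠ 0`, then
three more nonscalar multiplications give a cost-free `F` with the same homogeneous components as
`f` in degrees `≤ 3` (`E := κ⁻¹ (1 - d + d² - d³)`, `d := D/κ - 1`, `F := (D f) · E = f (1 - d⁴)`). -/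
def TruncatedDivision : Prop :=
  ∀ (σ : Type) (gs : List (MvPolynomial σ ℂ)) (f D : MvPolynomial σ ℂ), IsNonscalarSeq gs →
    D * f ∈ freeSpan {x | x ∈ gs} → D ∈ freeSpan {x | x ∈ gs} → coeff 0 D ≠ 0 →
    ∃ gs' : List (MvPolynomial σ ℂ), IsNonscalarSeq gs' ∧ gs'.length ≤ gs.length + 3 ∧
      ∃ F ∈ freeSpan {x | x ∈ gs'}, ∀ j ≤ 3, homogeneousComponent j F = homogeneousComponent j f

/-- The unipotent block matrix `M(A,B) = [[I, A, 0], [0, I, B], [0, 0, I]]` (group `2` unused). -/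
def blockM₂ (t : ℕ) :
    Matrix (Fin 3 × Fin t) (Fin 3 × Fin t) (MvPolynomial (Fin 3 × Fin t × Fin t) ℂ) :=
  Matrix.of fun p q =>
    if p.1 = q.1 then (if p.2 = q.2 then 1 else 0)
    else if p.1 = 0 ∧ q.1 = 1 then X ((0 : Fin 3), p.2, q.2)
    else if p.1 = 1 ∧ q.1 = 2 then X ((1 : Fin 3), p.2, q.2) else 0

/-- Its explicit inverse `[[I, -A, AB], [0, I, -B], [0, 0, I]]`. -/
def blockM₂inv (t : ℕ) :
    Matrix (Fin 3 × Fin t) (Fin 3 × Fin t) (MvPolynomial (Fin 3 × Fin t × Fin t) ℂ) :=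
  Matrix.of fun p q =>
    if p.1 = q.1 then (if p.2 = q.2 then 1 else 0)
    else if p.1 = 0 ∧ q.1 = 1 then -X ((0 : Fin 3), p.2, q.2)
    else if p.1 = 1 ∧ q.1 = 2 then -X ((1 : Fin 3), p.2, q.2)
    else if p.1 = 0 ∧ q.1 = 2 then ∑ j : Fin t, X ((0 : Fin 3), p.2, j) * X ((1 : Fin 3), j, q.2)
    else 0

/-- Second lemma of `adjugate-jet` (the read-off): `adj M(A,B) = M(A,B)⁻¹` has the product `A B` as
its `(0,2)` block — the gradient `∂ det / ∂ z_{ji} = adj_{ij}` of the determinant at the unipotent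
point carries matrix multiplication in degree `(1,1)`. -/
def UnipotentAdjugate : Prop :=
  ∀ t : ℕ, (blockM₂ t).det = 1 ∧ (blockM₂ t).adjugate = blockM₂inv t

/-- TRANSFER TARGET of `adjugate-jet` (same shape as `UniformRankBound`, constant `24 s + 18`). -/
def UniformRankBound' : Prop :=
  ∀ (t m' : ℕ) (h : 3 * t ≤ m') (s : ℕ),
    Derivable ℂ s
      (Set.range fun p : Fin (3 * t) × Fin m' =>
        algebraMap (MvPolynomial (Fin (3 * t) × Fin m') ℂ)
          (FractionRing (MvPolynomial (Fin (3 * t) × Fin m') ℂ)) (MvPolynomial.X p))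
      {algebraMap (MvPolynomial (Fin (3 * t) × Fin m') ℂ)
        (FractionRing (MvPolynomial (Fin (3 * t) × Fin m') ℂ))
        (Matrix.det (Matrix.of fun i j : Fin (3 * t) => MvPolynomial.X (i, Fin.castLE h j)))} →
    tensorRank (matMulTensor ℂ t t t) ≤ 24 * s + 18

/-- Exponent bookkeeping shared by both cards (in-tree pattern: `omega_le_of_mem_admissibleExponents`,
`Asymptotics.IsBigO.of_bound`): a uniform rank inequality plus the crux hypothesis at `n := 3t` gives
the crux. Stated here only to record that the composition typechecks against the crux BY NAME. -/
def TransferCloses : Prop :=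
  UniformRankBound →
    Summit.MatrixMultiplication.MatrixMultiplication.Theses.CondensationDistance.DerivationsBoundOmega


/-! ## Part A ⇒ Part B links -/

theorem cubicTruncation_holds : CubicTruncation :=
  fun R _ σ gs h => cubicTruncation (R := R) (σ := σ) (gs := gs) h

theorem trilinearExtraction_holds : TrilinearExtraction :=
  fun R _ _ _ _ _ _ x y z hxy hyz hxz N p h =>
    exists_triads_trilinear_of_isNonscalarSeq (R := R) x y z hxy hyz hxz (N := N) p h

/-- **The transfer is real (PROVED): the uniform rank inequality `C⁺` implies the crux BY NAME.**
Exponent bookkeeping only: at `n := 3t` the crux hypothesis and `C⁺` give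
`R(⟨t,t,t⟩) ≤ 24 s ≤ 24 |C| 3^τ · t^τ` for all `t ≥ n₀`, so `τ` is an admissible exponent and
`omega ℂ ≤ τ` (`omega_le_of_mem_admissibleExponents`). -/
theorem transferCloses : TransferCloses := by
  rintro hU τ _hτ ⟨C, n₀, hC⟩
  apply omega_le_of_mem_admissibleExponents
  refine Asymptotics.IsBigO.of_bound (24 * |C| * (3 : ℝ) ^ τ) ?_
  filter_upwards [Filter.eventually_ge_atTop n₀] with t ht
  obtain ⟨m', h, s, hs, hD⟩ := hC (3 * t) (by omega)
  have hR : tensorRank (matMulTensor ℂ t t t) ≤ 24 * s := hU t m' h s hD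
  rw [Real.norm_of_nonneg (Nat.cast_nonneg _),
    Real.norm_of_nonneg (Real.rpow_nonneg (Nat.cast_nonneg _) _)]
  have ht0 : (0 : ℝ) ≤ (t : ℝ) := Nat.cast_nonneg _
  have hpow : (0 : ℝ) ≤ (3 * (t : ℝ)) ^ τ := Real.rpow_nonneg (by positivity) _
  have hsR : (s : ℝ) ≤ |C| * (3 * (t : ℝ)) ^ τ := by
    have hs' : (s : ℝ) ≤ C * (3 * (t : ℝ)) ^ τ := by
      have := hs
      push_cast at this
      exact this
    exact hs'.trans (mul_le_mul_of_nonneg_right (le_abs_self C) hpow)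
  have h3t : (3 * (t : ℝ)) ^ τ = (3 : ℝ) ^ τ * (t : ℝ) ^ τ := Real.mul_rpow (by norm_num) ht0
  calc (tensorRank (matMulTensor ℂ t t t) : ℝ) ≤ ((24 * s : ℕ) : ℝ) := by exact_mod_cast hR
    _ = 24 * (s : ℝ) := by push_cast; ring
    _ ≤ 24 * (|C| * (3 * (t : ℝ)) ^ τ) := by nlinarith [hsR]
    _ = 24 * |C| * (3 : ℝ) ^ τ * (t : ℝ) ^ τ := by rw [h3t]; ring

end Summit.MatrixMultiplication.MatrixMultiplication.Cruxes.DerivationsBoundOmega.Ideas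

end
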